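import Literature.MathematicalPhysics.QuantumFieldTheory.Balaban1983to89.T4BoundaryRate

/-!
# BoundaryRateRegularKernel — the REGULAR-input channel of the boundary-member frame ONE LEVEL DOWN: `EKernelContracts` from a
per-parent damping of the regular kernel × the regular parents' slice geometry count, by transporting the parent's B-channel
lemmas through a channel swap (cell `pub-balaban`, T⁴ fan-out, `HOME/BINDER-OWNERS.md` row NE5, route P3 «boundary-functional
member»; ROUND-2 skeleton `t4/skeletons/NE5-t4-ne5-p3.md` leaf L15; lineage t4-ne5-p3 gen 17; bookkeeping only; imports the Literature
leaf `T4BoundaryRate` (v1.6.2) ONLY and modifies nothing of it)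

HONEST FRAMING (T4-DAG PAGE 1; identical to the parent's).  The cell's T⁴ target is rung (B)+1: existence AND uniqueness of the
ε → 0 limit of Bałaban's unit-scale averaged loop expectations on a FIXED finite torus — strictly beyond ultraviolet stability,
NOT infinite volume, NOT a mass gap, NOT the Clay problem.  HONEST DEPENDENCY (cell line, verbatim): «continuum YM on T⁴ ⇐
BetaPertH ∧ nine spine estimates (0/9 proved); BetaPertH ⇐ (D1) ∧ (D4) ∧ CAP+tail; G-an2-4 gates asym, D1 and NE2/3/4.»  This
module asserts NOTHING about Bałaban's objects; every `def … : Prop` is a parametrised HYPOTHESIS SHAPE, every theorem [folklore]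
bookkeeping.  `T4BoundaryCarrier.NE5B` is NOT PRINTED and NOT proved here.

WHY (leaf granularity of skeleton leaf L15).  The renewal `T4BoundaryRate.ne5B_of_generation` takes the regular-input channel as ONE
binder `EKernelContracts G κ θ lamE` — «the E∕R-input kernel maps the regular inputs' rate profile `θ^{scale Y}e^{−κd(Y)}` into
`lamE·θ^{scale X}e^{−κd(X)}`», any mass `lamE` (no smallness is needed: it multiplies the sibling members' constant once).  But a
SCALE-UNIFORM finite `lamE` hides the same two located facts as the boundary channel: the regular parents of step `j` inside an
output are MANY (volume entropy `V^{scale X − j}`, the output's own length) and their profile is LARGER than the output's by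
`θ^{−(scale X − j)}`; so `lamE < ∞` uniformly needs a per-parent DAMPING of the regular kernel strictly faster than `θ/V` and the
output-decay weight — for the regular inputs this damping IS the printed one-run irrelevance gain of ANY power ([Balaban1987RG1]
(3.5)–(3.9) p. 271, «a small factor O((L^jη)^N) with an arbitrary power N», p. 272 «the exponential factor exp(−δκ(L^jη)^{−1})
directly from the bound (1.18)»; applied to the boundary generation by [Balaban1988Convergent] p. 276), CONTEXT only — the two-run
kernel inheriting it is NOT PRINTED (cell GAPS G-ne5p3-1∕-2).  This module makes the structure explicit WITHOUT new proofs: the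
regular channel of a generation datum, read as a generation datum of its own (`swapE`: parents := eparents, K := KE), turns the
parent's §2∕§6∕§7∕§9 lemmas into their regular-channel twins BY NAME.

CONTENTS.  §1 `swapE` and the `Iff.rfl` dictionary (`kernelContracts_swapE`, `kernelDamped_swapE`, …); §2 the regular-channel shapes
`EKernelDamped`, `EPerParentDamped`, `ESliceCountGrowing`, `EExpDamped`; §3 the producers `eKernelContracts_of_damped`,
`eKernelDamped_of_perParent_growing`, `eKernelContracts_of_perParent_growing` (finite `lamE = k₀·Mc·(ωV/θ)/(1 − ωV/θ)` from
`ω·V < θ`), `ePerParentDamped_of_expDamped` (any power); §4 non-degeneracy on the parent's chain instance with the channels swapped.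
Names used — `T4BoundaryRate`: `Generation`, `KernelContracts`, `EKernelContracts`, `KernelDamped`, `PerParentDamped`, `SliceCountGrowing`,
`ExpDamped`, `kernelContracts_of_damped`, `kernelDamped_of_perParent_growing`, `perParentDamped_of_expDamped`, `inv_pow_mul_pow_lt`,
`chainCarriers`, `chainGeneration`, `chain_kernelContracts_one`.  Cell record: skeleton `t4/skeletons/NE5-t4-ne5-p3.md` §3 L15 (v1.3 re-types L15 with these names).
-/

namespace Summit.QuantumFields.BalabanUV.T4Continuum.BoundaryRateRegularKernel

open Finset
open Literature.MathematicalPhysics.QuantumFieldTheory.Balaban1983to89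
open T4OutputRate T4BoundaryCarrier T4BoundaryRate

variable {C : T4BoundaryCarrier.Carriers}

/-! ## §1 The channel swap -/

/-- THE REGULAR CHANNEL AS A GENERATION DATUM OF ITS OWN [bookkeeping]: parents := the regular inputs `eparents`, kernel := `KE`; no
second channel. -/
def swapE (G : Generation C) : Generation C where
  parents := G.eparents
  parents_lt := G.eparents_lt
  eparents := fun _ => ∅
  eparents_lt := fun _ _ h => by simp at h
  K := G.KE
  K_nonneg := G.KE_nonneg
  KE := fun _ _ => 0
  KE_nonneg := fun _ _ => le_rfl

/-- The swapped datum's parents are the regular inputs. [folklore] -/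
@[simp] theorem swapE_parents (G : Generation C) : (swapE G).parents = G.eparents := rfl

/-- The swapped datum's kernel is the regular kernel. [folklore] -/
@[simp] theorem swapE_K (G : Generation C) : (swapE G).K = G.KE := rfl

/-- `EKernelContracts` IS `KernelContracts` of the swapped datum — by definition. [folklore] -/
theorem kernelContracts_swapE (G : Generation C) (κ θ lam : ℝ) :
    KernelContracts (swapE G) κ θ lam ↔ EKernelContracts G κ θ lam := Iff.rfl

/-! ## §2 The regular-channel shapes (binders only — nothing asserted) -/

/-- **HYPOTHESIS SHAPE `EKernelDamped`** (NOT PRINTED for the two-run kernel; the scale-sliced form of the regular channel): the total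
influence of the regular inputs OF CREATION STEP `j` on the piece at `X`, decay weights included, is at most `M·ω^{scale X − j}e^{−κd(X)}`.
[bookkeeping] [cite: Balaban1987RG1, (3.9) p.271] -/
def EKernelDamped (G : Generation C) (κ ω M : ℝ) : Prop :=
  ∀ X : C.Dom, ∀ j ∈ range (C.scale X),
    ∑ Y ∈ (G.eparents X).filter (fun Y => C.scale Y = j), G.KE X Y * Real.exp (-(κ * C.d Y)) ≤
      M * ω ^ (C.scale X - j) * Real.exp (-(κ * C.d X))

/-- `EKernelDamped` IS `KernelDamped` of the swapped datum. [folklore] -/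
theorem kernelDamped_swapE (G : Generation C) (κ ω M : ℝ) : KernelDamped (swapE G) κ ω M ↔ EKernelDamped G κ ω M := Iff.rfl

/-- **HYPOTHESIS SHAPE `EPerParentDamped`** (NOT PRINTED for the two-run kernel): the regular kernel is damped per parent by
`k₀·ω^{scale separation}` times a weight. [bookkeeping] [cite: Balaban1987RG1, (3.9) p.271] -/
def EPerParentDamped (G : Generation C) (ω k₀ : ℝ) (w : C.Dom → C.Dom → ℝ) : Prop :=
  ∀ X : C.Dom, ∀ Y ∈ G.eparents X, G.KE X Y ≤ k₀ * ω ^ (C.scale X - C.scale Y) * w X Y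

/-- `EPerParentDamped` IS `PerParentDamped` of the swapped datum. [folklore] -/
theorem perParentDamped_swapE (G : Generation C) (ω k₀ : ℝ) (w : C.Dom → C.Dom → ℝ) :
    PerParentDamped (swapE G) ω k₀ w ↔ EPerParentDamped G ω k₀ w := Iff.rfl

/-- **HYPOTHESIS SHAPE `ESliceCountGrowing`** (COMBINATORIAL, one run): the weighted, decay-weighted count of the REGULAR parents of
step `j` inside the output — the same geometry as the boundary channel's `SliceCountGrowing` (volume entropy `V` per step; the
output's length absorbed by the weight's surplus decay; [Balaban1987RG1] (0.26) p. 257 is the printed one-run summability).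
[bookkeeping] [cite: Balaban1987RG1, (0.26) p.257] -/
def ESliceCountGrowing (G : Generation C) (κ : ℝ) (w : C.Dom → C.Dom → ℝ) (Mc V : ℝ) : Prop :=
  ∀ X : C.Dom, ∀ j ∈ range (C.scale X),
    ∑ Y ∈ (G.eparents X).filter (fun Y => C.scale Y = j), w X Y * Real.exp (-(κ * C.d Y)) ≤
      Mc * V ^ (C.scale X - j) * Real.exp (-(κ * C.d X))

/-- `ESliceCountGrowing` IS `SliceCountGrowing` of the swapped datum. [folklore] -/
theorem sliceCountGrowing_swapE (G : Generation C) (κ : ℝ) (w : C.Dom → C.Dom → ℝ) (Mc V : ℝ) :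
    SliceCountGrowing (swapE G) κ w Mc V ↔ ESliceCountGrowing G κ w Mc V := Iff.rfl

/-- **HYPOTHESIS SHAPE `EExpDamped`** (the printed ONE-RUN irrelevance gain typed for the two-run regular kernel — NOT PRINTED as such):
`KE X Y ≤ k₀·exp(−c·L^{scale X − scale Y})·w X Y`, the literal shape of (3.9)∕p. 272 of [Balaban1987RG1] («O((L^jη)^N) with an arbitrary
power N»). [bookkeeping] [cite: Balaban1987RG1, (3.9) p.271] -/
def EExpDamped (G : Generation C) (L c k₀ : ℝ) (w : C.Dom → C.Dom → ℝ) : Prop :=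
  ∀ X : C.Dom, ∀ Y ∈ G.eparents X, G.KE X Y ≤ k₀ * Real.exp (-(c * L ^ (C.scale X - C.scale Y))) * w X Y

/-- `EExpDamped` IS `ExpDamped` of the swapped datum. [folklore] -/
theorem expDamped_swapE (G : Generation C) (L c k₀ : ℝ) (w : C.Dom → C.Dom → ℝ) :
    ExpDamped (swapE G) L c k₀ w ↔ EExpDamped G L c k₀ w := Iff.rfl

/-! ## §3 The producers of `EKernelContracts`, by name through the swap -/

/-- **SLICE DAMPING ⇒ CONTRACTION for the regular channel** [folklore]: `EKernelDamped ω M` with `ω < θ` gives `EKernelContracts` with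
mass `M(ω/θ)/(1 − ω/θ)` — the parent's `kernelContracts_of_damped` on the swapped datum. -/
theorem eKernelContracts_of_damped {G : Generation C} {κ θ ω M : ℝ} (hθ : 0 < θ) (hω : 0 ≤ ω) (hωθ : ω < θ) (hM : 0 ≤ M)
    (h : EKernelDamped G κ ω M) : EKernelContracts G κ θ (M * (ω / θ) / (1 - ω / θ)) :=
  (kernelContracts_swapE G κ θ _).mp (kernelContracts_of_damped hθ hω hωθ hM ((kernelDamped_swapE G κ ω M).mpr h))

/-- **PER-PARENT DAMPING × SLICE GEOMETRY ⇒ SLICE DAMPING for the regular channel** [folklore] (the parent's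
`kernelDamped_of_perParent_growing` on the swapped datum): damping ratio `ω·V`, constant `k₀·Mc`. -/
theorem eKernelDamped_of_perParent_growing {G : Generation C} {κ ω k₀ Mc V : ℝ} {w : C.Dom → C.Dom → ℝ}
    (hω : 0 ≤ ω) (hk₀ : 0 ≤ k₀) (hP : EPerParentDamped G ω k₀ w) (hS : ESliceCountGrowing G κ w Mc V) :
    EKernelDamped G κ (ω * V) (k₀ * Mc) :=
  (kernelDamped_swapE G κ _ _).mp
    (kernelDamped_of_perParent_growing hω hk₀ ((perParentDamped_swapE G ω k₀ w).mpr hP)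
      ((sliceCountGrowing_swapE G κ w Mc V).mpr hS))

/-- **THE REGULAR CHANNEL ONE LEVEL DOWN** [folklore]: per-parent damping `ω` with weight `w` + the regular parents' slice count with
volume entropy `V` + the effective-damping condition `ω·V < θ` ⟹ `EKernelContracts` with the FINITE, scale-uniform mass
`lamE = k₀·Mc·(ωV/θ)/(1 − ωV/θ)`.  So the honest content of skeleton leaf L15 is: the regular kernel's damping must beat the rate
times the volume entropy — exactly as for the boundary channel, except that no smallness of `lamE` itself is required downstream. -/
theorem eKernelContracts_of_perParent_growing {G : Generation C} {κ θ ω k₀ Mc V : ℝ} {w : C.Dom → C.Dom → ℝ}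
    (hθ : 0 < θ) (hω : 0 ≤ ω) (hV : 0 ≤ V) (hωθ : ω * V < θ) (hk₀ : 0 ≤ k₀) (hMc : 0 ≤ Mc)
    (hP : EPerParentDamped G ω k₀ w) (hS : ESliceCountGrowing G κ w Mc V) :
    EKernelContracts G κ θ (k₀ * Mc * (ω * V / θ) / (1 - ω * V / θ)) :=
  eKernelContracts_of_damped hθ (mul_nonneg hω hV) hωθ (mul_nonneg hk₀ hMc) (eKernelDamped_of_perParent_growing hω hk₀ hP hS)

/-- **THE PRINTED-SHAPE GAIN, regular channel** [folklore]: `EExpDamped L c k₀ w` gives `EPerParentDamped ((L^N)⁻¹) (k₀(N/(ce))^N) w`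
for ANY power `N` — the parent's `perParentDamped_of_expDamped` on the swapped datum; with `N` above the volume-entropy and rate
exponents the condition `(L^N)⁻¹·V < θ` of `eKernelContracts_of_perParent_growing` is met (`T4BoundaryRate.inv_pow_mul_pow_lt`). -/
theorem ePerParentDamped_of_expDamped {G : Generation C} {L c k₀ : ℝ} {w : C.Dom → C.Dom → ℝ}
    (hL : 0 < L) (hc : 0 < c) (hk₀ : 0 ≤ k₀) (hw : ∀ X : C.Dom, ∀ Y ∈ G.eparents X, 0 ≤ w X Y)
    (h : EExpDamped G L c k₀ w) (N : ℕ) :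
    EPerParentDamped G ((L ^ N)⁻¹) (k₀ * ((N : ℝ) / (c * Real.exp 1)) ^ N) w :=
  (perParentDamped_swapE G _ _ w).mp
    (perParentDamped_of_expDamped (G := swapE G) hL hc hk₀ hw ((expDamped_swapE G L c k₀ w).mpr h) N)

/-- **END-TO-END for the regular channel from the printed-shape gain** [folklore]: `EExpDamped` + `ESliceCountGrowing w Mc (L^b)` with
rate `θ = (L^a)⁻¹` and any `N ≥ a + b + 1` give `EKernelContracts` with an explicit finite mass. -/
theorem eKernelContracts_of_expDamped {G : Generation C} {κ L c k₀ Mc : ℝ} {w : C.Dom → C.Dom → ℝ} (N a b : ℕ)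
    (hL : 1 < L) (hc : 0 < c) (hk₀ : 0 ≤ k₀) (hMc : 0 ≤ Mc) (hw : ∀ X : C.Dom, ∀ Y ∈ G.eparents X, 0 ≤ w X Y)
    (h : EExpDamped G L c k₀ w) (hS : ESliceCountGrowing G κ w Mc (L ^ b)) (hN : a + b < N) :
    EKernelContracts G κ ((L ^ a)⁻¹)
      (k₀ * ((N : ℝ) / (c * Real.exp 1)) ^ N * Mc * ((L ^ N)⁻¹ * L ^ b / (L ^ a)⁻¹) /
        (1 - (L ^ N)⁻¹ * L ^ b / (L ^ a)⁻¹)) := by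
  have hL0 : 0 < L := lt_trans zero_lt_one hL
  exact eKernelContracts_of_perParent_growing (inv_pos.mpr (pow_pos hL0 a)) (inv_nonneg.mpr (pow_nonneg hL0.le N))
    (pow_nonneg hL0.le b) (inv_pow_mul_pow_lt hL hN) (by positivity) hMc (ePerParentDamped_of_expDamped hL0 hc hk₀ hw h N) hS

/-! ## §4 Non-degeneracy: the parent's chain instance moved to the regular channel -/

/-- The chain of `T4BoundaryRate` §4 read as a REGULAR channel: piece `n + 1` has the regular input `n` with kernel `k₀`, no boundary
parents. [folklore] -/
def echain (k₀ : ℝ) (hk : 0 ≤ k₀) : Generation chainCarriers where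
  parents := fun _ => ∅
  parents_lt := fun _ _ h => by simp at h
  eparents := (chainGeneration k₀ hk).parents
  eparents_lt := (chainGeneration k₀ hk).parents_lt
  K := fun _ _ => 0
  K_nonneg := fun _ _ => le_rfl
  KE := (chainGeneration k₀ hk).K
  KE_nonneg := (chainGeneration k₀ hk).K_nonneg

/-- Swapping the regular chain gives back the boundary chain. [folklore] -/
theorem swapE_echain (k₀ : ℝ) (hk : 0 ≤ k₀) : swapE (echain k₀ hk) = chainGeneration k₀ hk := rfl

/-- On the regular chain with kernel `θ` the regular channel reproduces the rate profile EXACTLY: `EKernelContracts` with mass `1`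
(the regular twin of `T4BoundaryRate.chain_kernelContracts_one`) — the shapes of §2 are not vacuous and a finite mass is a genuine
damping statement. [folklore] -/
theorem echain_eKernelContracts_one {θ : ℝ} (hθ : 0 ≤ θ) : EKernelContracts (echain θ hθ) 0 θ 1 := by
  rw [← kernelContracts_swapE, swapE_echain]
  exact chain_kernelContracts_one hθ

end Summit.QuantumFields.BalabanUV.T4Continuum.BoundaryRateRegularKernel
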